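import Mathlib
import Summits.ValiantsHypothesis.ValiantsHypothesis.Theorems.NewtonUnitEquationsTwoProductsFormalLogLinearisationLiftedSeparatedPencil
import Summits.ValiantsHypothesis.ValiantsHypothesis.Theorems.NewtonUnitEquationsTwoProductsFormalLogLinearisationLiftedBox
import HarnessLib

/-!
# Route NewtonUnitEquations — crux `TwoProducts` (stmt-ValiantsHypothesis-5906), line `formal-log-linearisation`:
# the lifted pencil count on a pencil plane of coordinate-OVERLAP `k` is `≤ n^(k+1)` (`n` terms; `n = 2m`)

Registered line `Cruxes/TwoProducts/Lines/formal-log-linearisation.lean` (NOT the item's skeleton of record; helper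
mode `--supports stmt-ValiantsHypothesis-5906 --as helper`, no stub credit claimed).  Sequel to
`…LiftedSeparatedPencil.lean` (`≤ 2m` on coordinate-split pencil planes, overlap `0`) in the general currency of
`…LiftedBox.lean` (`ExpSum`: a finite signed sum `F(ν) = Σ_k c_k ∏_i a_{ki}^{ν_i}` of monomial characters on `ℕ^s`).

* `card_le_of_triangular_factor'` — the `Fin`-indexed rank obstruction with an arbitrary finite inner index type;
* `ExpSum.crossover_eq` — `F` at a crossover `(μ on {v = 0}, μ' elsewhere)` factors through the index type;
* `ExpSum.pencilCount_separatedPencil` — **`≤ |κ|` pencil-visible points of `{F ≠ 0}` on every separated pencil**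
  `u + c·v` (`u_i = 0 ∨ v_i = 0`; no sign hypotheses), by Hankel rank + crossover exactly as for two configurations;
* `ExpSum.pencilCount_fibre` — if `u_i v_i = 0` only OFF a coordinate set `K`, the visible points with a prescribed
  restriction to `K` number `≤ |κ|`: freeze the `K`-exponents into the coefficients, zero them in the points, and give the
  `K`-coordinates the dummy split grading `(1, 0)`; visibility transfers;
* `ExpSum.pencilCount_overlap` — **for nonnegative `u, v` with `u_i + v_i > 0` and overlap set
  `K ⊇ {i : u_i ≠ 0 ∧ v_i ≠ 0}`, every finite set of `(u + cv)`-pencil-visible points of `{F ≠ 0}` has at most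
  `|κ|^(#K + 1)` elements** (Box lemma `ExpSum.minimal_lt_card`: the `K`-restrictions take `≤ |κ|^#K` values);
* `liftedPencilCount_overlap`, `liftedPencilCount_overlapPlane` — the two-configuration instances (`|κ| = 2m`): `≤ (2m)^(#K+1)`
  for generators `(u, v)`, and for strictly positive `θ₁ = αu + βv`, `θ₂ = γu + δv` (`α, β, γ, δ > 0`) in the memo's
  verbatim `LiftedPencilCount` hypothesis shape.

So the memo's `m`-uniform count `2^{am}(s+2)^b` holds on every pencil plane meeting at most `O(m / log m)` coordinates in
both generators; the open content of `LiftedPencilCount` is to replace the multiplicative `(2m)^k` of the slicing by an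
additive dependence on the overlap.  Honest framing: elementary (rank + slicing) for the THEORY lane of an OPEN engine;
`stub_logSumEngine`, the crux `TwoProducts` and the `m`-uniformity of `LiftedPencilCount` stay OPEN, the line is not the
item's skeleton of record, and nothing here is progress on `VP ≠ VNP` (NOT proved).  No definitions, no named facts.
[folklore]
-/

noncomputable section

-- Sub = Summit single-conjunct layout: the duplicated namespace component is mandated by the tree.
set_option linter.dupNamespace false

namespace Summit.ValiantsHypothesis.ValiantsHypothesis.Theorems.NewtonUnitEquations.TwoProducts.FormalLogLinearisation

open scoped BigOperators

/-- **Rank obstruction, arbitrary finite inner index** (cf. `card_le_of_triangular_factor`): if the `t × t` matrix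
`P * Q` factors through the finite type `n` and is lower triangular with nonzero diagonal, then `t ≤ |n|`. [folklore] -/
theorem card_le_of_triangular_factor' {K : Type*} [Field K] {t : ℕ} {n : Type*} [Fintype n]
    (P : Matrix (Fin t) n K) (Q : Matrix n (Fin t) K) (hdiag : ∀ a, (P * Q) a a ≠ 0)
    (hupper : ∀ a b, a < b → (P * Q) a b = 0) : t ≤ Fintype.card n := by
  classical
  set M : Matrix (Fin t) (Fin t) K := P * Q with hM
  have htri : M.BlockTriangular OrderDual.toDual := fun a b hab => hupper a b (by simpa using hab)
  have hdet : M.det ≠ 0 := by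
    rw [Matrix.det_of_lowerTriangular M htri]
    exact Finset.prod_ne_zero_iff.2 (fun a _ => hdiag a)
  have hunit : IsUnit M := (Matrix.isUnit_iff_isUnit_det M).2 (isUnit_iff_ne_zero.2 hdet)
  have h1 : M.rank = t := by rw [Matrix.rank_of_isUnit M hunit, Fintype.card_fin]
  have h2 : M.rank ≤ Fintype.card n := by
    rw [hM]
    exact (Matrix.rank_mul_le_left P Q).trans (Matrix.rank_le_card_width P)
  omega

namespace ExpSum

variable {s : ℕ}

/-- **Characters are multiplicative** (general signed exponential sum): with the crossover
`cross = (μ on {v = 0}, μ' elsewhere)`, `Σ_k (c_k ∏_{v_i=0} a_{ki}^{μ_i}) · ∏_{v_i≠0} a_{ki}^{μ'_i} = F(cross)`. [folklore] -/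
theorem crossover_eq {κ : Type*} [Fintype κ] (c : κ → ℂ) (a : κ → Fin s → ℂ) (v : Fin s → ℝ)
    (μ μ' : Fin s → ℕ) :
    ∑ k, (c k * ∏ i, (if v i = 0 then a k i ^ μ i else 1)) *
        ∏ i, (if v i = 0 then (1 : ℂ) else a k i ^ μ' i) =
      ∑ k, c k * ∏ i, a k i ^ (fun i => if v i = 0 then μ i else μ' i) i := by
  refine Finset.sum_congr rfl fun k _ => ?_
  rw [mul_assoc, ← Finset.prod_mul_distrib]
  congr 1
  refine Finset.prod_congr rfl fun i _ => ?_
  by_cases h : v i = 0 <;> simp [h]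

/-- **Pencil count on a separated pencil, general signed exponential sum: `≤ |κ|`.**  For
`F(ν) = Σ_{k ∈ κ} c_k ∏_i a_{ki}^{ν_i}` and gradings `u, v : Fin s → ℝ` with `u_i = 0 ∨ v_i = 0` for every `i`, every
finite set of points `μ` with `F(μ) ≠ 0`, each the strict `(u + c·v)`-minimiser of `{F ≠ 0}` for some `c > 0`, has at
most `|κ|` elements (Hankel rank + crossover, as in `liftedPencilCount_separatedPencil`). [folklore] -/
theorem pencilCount_separatedPencil {κ : Type*} [Fintype κ] (c : κ → ℂ) (a : κ → Fin s → ℂ) (u v : Fin s → ℝ)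
    (hsep : ∀ i, u i = 0 ∨ v i = 0) (S : Finset (Fin s → ℕ))
    (hS : ∀ μ ∈ S, (∑ k, c k * ∏ i, a k i ^ μ i) ≠ 0 ∧
      ∃ t : ℝ, 0 < t ∧ ∀ ν : Fin s → ℕ, ν ≠ μ → (∑ k, c k * ∏ i, a k i ^ ν i) ≠ 0 →
        ∑ i, (u i + t * v i) * (μ i : ℝ) < ∑ i, (u i + t * v i) * (ν i : ℝ)) :
    S.card ≤ Fintype.card κ := by
  classical
  set X : (Fin s → ℕ) → ℝ := fun ν => ∑ i, u i * (ν i : ℝ) with hX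
  set Y : (Fin s → ℕ) → ℝ := fun ν => ∑ i, v i * (ν i : ℝ) with hY
  set F : (Fin s → ℕ) → ℂ := fun ν => ∑ k, c k * ∏ i, a k i ^ ν i with hF
  let cross : (Fin s → ℕ) → (Fin s → ℕ) → (Fin s → ℕ) := fun μ μ' i => if v i = 0 then μ i else μ' i
  have hcrossX : ∀ μ μ', X (cross μ μ') = X μ := fun μ μ' => crossover_X u v hsep μ μ'
  have hcrossY : ∀ μ μ', Y (cross μ μ') = Y μ' := fun μ μ' => crossover_Y v μ μ'
  have hvis : ∀ μ' ∈ S, ∃ t : ℝ, 0 < t ∧ ∀ ν, ν ≠ μ' → F ν ≠ 0 → X μ' + t * Y μ' < X ν + t * Y ν := by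
    intro μ' hμ'
    obtain ⟨t, ht, hmin⟩ := (hS μ' hμ').2
    refine ⟨t, ht, fun ν hν hG => ?_⟩
    have h := hmin ν hν hG
    simpa only [pencilWeight_split] using h
  -- crossovers with smaller `X` are killed
  have hkill : ∀ μ ∈ S, ∀ μ' ∈ S, X μ < X μ' → F (cross μ μ') = 0 := by
    intro μ _ μ' hμ' hlt
    by_contra hne
    obtain ⟨t, ht, hmin⟩ := hvis μ' hμ'
    have hne' : cross μ μ' ≠ μ' := by
      intro h
      have := hcrossX μ μ'
      rw [h] at this
      linarith
    have h := hmin (cross μ μ') hne' hne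
    rw [hcrossX, hcrossY] at h
    linarith
  -- `X` is injective on `S`
  have hinj : Set.InjOn X ↑S := by
    intro μ hμ μ' hμ' hXeq
    by_contra hne
    have hGμ : F μ ≠ 0 := (hS μ hμ).1
    have hGμ' : F μ' ≠ 0 := (hS μ' hμ').1
    rcases le_total (Y μ) (Y μ') with hle | hle
    · obtain ⟨t, ht, hmin⟩ := hvis μ' hμ'
      have h := hmin μ hne hGμ
      nlinarith
    · obtain ⟨t, ht, hmin⟩ := hvis μ hμ
      have h := hmin μ' (Ne.symm hne) hGμ'
      nlinarith
  -- enumerate `S` by increasing `X`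
  set t := S.card with ht
  have hTcard : (S.image X).card = t := Finset.card_image_of_injOn hinj
  let e : Fin t ↪o ℝ := (S.image X).orderEmbOfFin hTcard
  have he : ∀ b : Fin t, ∃ μ ∈ S, X μ = e b := fun b => by
    simpa only [Finset.mem_image] using (S.image X).orderEmbOfFin_mem hTcard b
  choose μ hμS hμX using he
  have hμlt : ∀ a' b' : Fin t, a' < b' → X (μ a') < X (μ b') := fun a' b' hab => by
    rw [hμX, hμX]; exact e.strictMono hab
  -- the crossover matrix factors through `κ` and is triangular with nonzero diagonal
  let P : Matrix (Fin t) κ ℂ := fun b k => c k * ∏ i, (if v i = 0 then a k i ^ μ b i else 1)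
  let Q : Matrix κ (Fin t) ℂ := fun k b => ∏ i, (if v i = 0 then (1 : ℂ) else a k i ^ μ b i)
  have hPQ : ∀ a' b', (P * Q) a' b' = F (cross (μ a') (μ b')) := fun a' b' => by
    simp only [Matrix.mul_apply, P, Q]
    exact crossover_eq c a v (μ a') (μ b')
  refine card_le_of_triangular_factor' P Q (fun a' => ?_) (fun a' b' hab => ?_)
  · rw [hPQ]
    have : cross (μ a') (μ a') = μ a' := crossover_self v (μ a')
    rw [this]
    exact (hS _ (hμS a')).1
  · rw [hPQ]
    exact hkill (μ a') (hμS a') (μ b') (hμS b') (hμlt a' b' hab)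

/-- **Fibres over an overlap set.**  Let `K` be a set of coordinates off which the pencil generators are separated
(`i ∉ K → u_i = 0 ∨ v_i = 0`), and `b̂` a prescribed exponent pattern.  The `(u + cv)`-pencil-visible points of
`{F ≠ 0}` that agree with `b̂` on `K` number at most `|κ|`: freezing the `K`-exponents into the coefficients
(`c'_k = c_k ∏_{i∈K} a_{ki}^{b̂_i}`, `a'_{ki} = 1` on `K`), zeroing them in the points, and grading the `K`-coordinates by
the dummy split pair `(1, 0)` transfers visibility to a separated pencil (`pencilCount_separatedPencil`). [folklore] -/
theorem pencilCount_fibre {κ : Type*} [Fintype κ] (c : κ → ℂ) (a : κ → Fin s → ℂ) (u v : Fin s → ℝ)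
    (K : Finset (Fin s)) (hK : ∀ i, i ∉ K → u i = 0 ∨ v i = 0) (bK : Fin s → ℕ) (T : Finset (Fin s → ℕ))
    (hT : ∀ μ ∈ T, (∀ i ∈ K, μ i = bK i) ∧ (∑ k, c k * ∏ i, a k i ^ μ i) ≠ 0 ∧
      ∃ t : ℝ, 0 < t ∧ ∀ ν : Fin s → ℕ, ν ≠ μ → (∑ k, c k * ∏ i, a k i ^ ν i) ≠ 0 →
        ∑ i, (u i + t * v i) * (μ i : ℝ) < ∑ i, (u i + t * v i) * (ν i : ℝ)) :
    T.card ≤ Fintype.card κ := by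
  classical
  set F : (Fin s → ℕ) → ℂ := fun ν => ∑ k, c k * ∏ i, a k i ^ ν i with hF
  -- zero the `K`-coordinates
  let z : (Fin s → ℕ) → (Fin s → ℕ) := fun μ i => if i ∈ K then 0 else μ i
  have hzinj : Set.InjOn z ↑T := by
    intro μ hμ μ' hμ' hz
    funext i
    by_cases hi : i ∈ K
    · rw [(hT μ hμ).1 i hi, (hT μ' hμ').1 i hi]
    · have := congrFun hz i
      simpa [z, hi] using this
  -- frozen coefficients, dummy characters and gradings on `K`
  let c' : κ → ℂ := fun k => c k * ∏ i, (if i ∈ K then a k i ^ bK i else 1)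
  let a' : κ → Fin s → ℂ := fun k i => if i ∈ K then 1 else a k i
  let u' : Fin s → ℝ := fun i => if i ∈ K then 1 else u i
  let v' : Fin s → ℝ := fun i => if i ∈ K then 0 else v i
  have hsep' : ∀ i, u' i = 0 ∨ v' i = 0 := by
    intro i
    by_cases hi : i ∈ K
    · right; simp [v', hi]
    · rcases hK i hi with h | h
      · left; simp [u', hi, h]
      · right; simp [v', hi, h]
  -- completing a point by `bK` on `K`
  let hat : (Fin s → ℕ) → (Fin s → ℕ) := fun ν i => if i ∈ K then bK i else ν i
  have hF' : ∀ ν, (∑ k, c' k * ∏ i, a' k i ^ ν i) = F (hat ν) := by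
    intro ν
    refine Finset.sum_congr rfl fun k _ => ?_
    simp only [c', a', hat]
    rw [mul_assoc, ← Finset.prod_mul_distrib]
    congr 1
    refine Finset.prod_congr rfl fun i _ => ?_
    by_cases hi : i ∈ K <;> simp [hi]
  have hhatz : ∀ μ ∈ T, hat (z μ) = μ := by
    intro μ hμ
    funext i
    by_cases hi : i ∈ K
    · simp [hat, hi, (hT μ hμ).1 i hi]
    · simp [hat, z, hi]
  -- the weight bookkeeping: `w'(ν) - w'(z μ) = (w(hat ν) - w(μ)) + Σ_{i∈K} ν_i`
  have hw : ∀ μ ∈ T, ∀ (t : ℝ) (ν : Fin s → ℕ),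
      (∑ i, (u' i + t * v' i) * (ν i : ℝ)) - ∑ i, (u' i + t * v' i) * (z μ i : ℝ) =
        ((∑ i, (u i + t * v i) * (hat ν i : ℝ)) - ∑ i, (u i + t * v i) * (μ i : ℝ)) +
          ∑ i, (if i ∈ K then (ν i : ℝ) else 0) := by
    intro μ hμ t ν
    rw [← Finset.sum_sub_distrib, ← Finset.sum_sub_distrib, ← Finset.sum_add_distrib]
    refine Finset.sum_congr rfl fun i _ => ?_
    by_cases hi : i ∈ K
    · simp [u', v', z, hat, hi, (hT μ hμ).1 i hi]
    · simp [u', v', z, hat, hi]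
  have hKnonneg : ∀ ν : Fin s → ℕ, 0 ≤ ∑ i, (if i ∈ K then (ν i : ℝ) else 0) := fun ν =>
    Finset.sum_nonneg fun i _ => by split_ifs <;> positivity
  -- apply the separated count to the zeroed points
  rw [← Finset.card_image_of_injOn hzinj]
  refine pencilCount_separatedPencil c' a' u' v' hsep' (T.image z) fun ξ hξ => ?_
  obtain ⟨μ, hμ, rfl⟩ := Finset.mem_image.1 hξ
  obtain ⟨hagree, hFμ, t, ht, hmin⟩ := hT μ hμ
  refine ⟨by rw [hF', hhatz μ hμ]; exact hFμ, t, ht, fun ν hν hFν => ?_⟩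
  rw [hF'] at hFν
  rw [← sub_pos, hw μ hμ t ν]
  by_cases hhat : hat ν = μ
  · -- same completion: `ν` differs from `z μ` on `K`, where it is positive
    rw [hhat, sub_self, zero_add]
    obtain ⟨i, hi⟩ : ∃ i, ν i ≠ z μ i := by
      by_contra h
      push Not at h
      exact hν (funext h)
    have hiK : i ∈ K := by
      by_contra hiK
      have h1 : z μ i = μ i := by simp [z, hiK]
      have h2 : hat ν i = ν i := by simp [hat, hiK]
      rw [h1, ← hhat, h2] at hi
      exact hi rfl
    have hνi : (1 : ℝ) ≤ ν i := by
      have : z μ i = 0 := by simp [z, hiK]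
      rw [this] at hi
      exact_mod_cast Nat.one_le_iff_ne_zero.2 hi
    refine lt_of_lt_of_le (by linarith : (0 : ℝ) < (ν i : ℝ)) ?_
    have := Finset.single_le_sum (f := fun i => if i ∈ K then (ν i : ℝ) else 0)
      (fun i _ => by split_ifs <;> positivity) (Finset.mem_univ i)
    simpa [hiK] using this
  · have h := hmin (hat ν) hhat hFν
    have := hKnonneg ν
    linarith

/-- **Pencil count on a pencil plane of coordinate-overlap `#K`: `≤ |κ|^(#K + 1)`.**  For nonnegative gradings
`u, v` with `u_i + v_i > 0` that are separated off `K` (`i ∉ K → u_i = 0 ∨ v_i = 0`), every finite set of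
`(u + cv)`-pencil-visible points of `{F ≠ 0}` has at most `|κ|^(#K+1)` elements: by the Box lemma
(`ExpSum.minimal_lt_card`) the restrictions to `K` take at most `|κ|^#K` values, and each fibre has `≤ |κ|` points
(`pencilCount_fibre`). [folklore] -/
theorem pencilCount_overlap {κ : Type*} [Fintype κ] (c : κ → ℂ) (a : κ → Fin s → ℂ) (u v : Fin s → ℝ)
    (hu : ∀ i, 0 ≤ u i) (hv : ∀ i, 0 ≤ v i) (hpos : ∀ i, 0 < u i + v i)
    (K : Finset (Fin s)) (hK : ∀ i, i ∉ K → u i = 0 ∨ v i = 0) (S : Finset (Fin s → ℕ))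
    (hS : ∀ μ ∈ S, (∑ k, c k * ∏ i, a k i ^ μ i) ≠ 0 ∧
      ∃ t : ℝ, 0 < t ∧ ∀ ν : Fin s → ℕ, ν ≠ μ → (∑ k, c k * ∏ i, a k i ^ ν i) ≠ 0 →
        ∑ i, (u i + t * v i) * (μ i : ℝ) < ∑ i, (u i + t * v i) * (ν i : ℝ)) :
    S.card ≤ Fintype.card κ ^ (K.card + 1) := by
  classical
  set n := Fintype.card κ with hn
  -- Box lemma: visible points have all coordinates `< n`
  have hbox : ∀ μ ∈ S, ∀ i, μ i < n := by
    intro μ hμ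
    obtain ⟨hFμ, t, ht, hmin⟩ := hS μ hμ
    have hθ : ∀ i, 0 < u i + t * v i := by
      intro i
      rcases lt_or_ge 0 (v i) with h | h
      · have := mul_pos ht h
        linarith [hu i]
      · have hv0 : v i = 0 := le_antisymm h (hv i)
        have := hpos i
        rw [hv0] at this ⊢
        simpa using this
    refine minimal_lt_card c a (fun i => u i + t * v i) hθ μ hFμ fun ν hlt => ?_
    by_contra hne
    have hνμ : ν ≠ μ := by
      rintro rfl
      exact lt_irrefl _ hlt
    have := hmin ν hνμ hne
    linarith
  -- restriction to `K`
  let f : (Fin s → ℕ) → (↥K → ℕ) := fun μ i => μ i.1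
  have hfib : ∀ b ∈ S.image f, (S.filter fun μ => f μ = b).card ≤ n := by
    intro b _
    refine pencilCount_fibre c a u v K hK (fun i => if h : i ∈ K then b ⟨i, h⟩ else 0)
      (S.filter fun μ => f μ = b) fun μ hμ => ?_
    obtain ⟨hμS, hfμ⟩ := Finset.mem_filter.1 hμ
    refine ⟨fun i hi => ?_, hS μ hμS⟩
    rw [dif_pos hi, ← hfμ]
  have himg : S.image f ⊆ Fintype.piFinset fun _ : ↥K => Finset.range n := by
    intro b hb
    obtain ⟨μ, hμ, rfl⟩ := Finset.mem_image.1 hb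
    exact Fintype.mem_piFinset.2 fun i => Finset.mem_range.2 (hbox μ hμ i.1)
  have hcard : (S.image f).card ≤ n ^ K.card := by
    refine (Finset.card_le_card himg).trans ?_
    rw [Fintype.card_piFinset, Finset.prod_const, Finset.card_range, Finset.card_univ, Fintype.card_coe]
  calc S.card ≤ n * (S.image f).card := Finset.card_le_mul_card_image S n hfib
    _ ≤ n * n ^ K.card := Nat.mul_le_mul_left n hcard
    _ = n ^ (K.card + 1) := by ring

end ExpSum

/-- The unequal-moment function of two `m`-point configurations as a signed exponential sum over `Fin m ⊕ Fin m`
(coefficients `+1` on the `A`-copies, `-1` on the `B`-copies). [folklore] -/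
theorem unequalMoment_eq_expSum {m s : ℕ} (A B : Fin m → Fin s → ℂ) (ν : Fin s → ℕ) :
    (∑ k : Fin m ⊕ Fin m, Sum.elim (fun _ => (1 : ℂ)) (fun _ => -1) k * ∏ i, Sum.elim A B k i ^ ν i) =
      (∑ j, ∏ i, A j i ^ ν i) - ∑ j, ∏ i, B j i ^ ν i := by
  rw [Fintype.sum_sum_type]
  simp [sub_eq_add_neg, Finset.sum_neg_distrib]

/-- **Lifted pencil count on a pencil plane of coordinate-overlap `#K`: `≤ (2m)^(#K+1)`** (two `m`-point
configurations `A, B ⊂ ℂ^s`; nonnegative generators `u, v` with `u_i + v_i > 0`, separated off `K`).  `#K = 0` is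
`liftedPencilCount_separatedPencil`; in general the memo's `m`-uniform bound holds whenever `#K = O(m / log m)`.
[folklore] -/
theorem liftedPencilCount_overlap {m s : ℕ} (A B : Fin m → Fin s → ℂ) (u v : Fin s → ℝ)
    (hu : ∀ i, 0 ≤ u i) (hv : ∀ i, 0 ≤ v i) (hpos : ∀ i, 0 < u i + v i)
    (K : Finset (Fin s)) (hK : ∀ i, i ∉ K → u i = 0 ∨ v i = 0) (S : Finset (Fin s → ℕ))
    (hS : ∀ μ ∈ S, (∑ j, ∏ i, A j i ^ μ i) ≠ (∑ j, ∏ i, B j i ^ μ i) ∧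
      ∃ c : ℝ, 0 < c ∧ ∀ ν : Fin s → ℕ, ν ≠ μ →
        (∑ j, ∏ i, A j i ^ ν i) ≠ (∑ j, ∏ i, B j i ^ ν i) →
          ∑ i, (u i + c * v i) * (μ i : ℝ) < ∑ i, (u i + c * v i) * (ν i : ℝ)) :
    S.card ≤ (2 * m) ^ (K.card + 1) := by
  have hcardκ : Fintype.card (Fin m ⊕ Fin m) = 2 * m := by simp [Fintype.card_sum, two_mul]
  rw [← hcardκ]
  refine ExpSum.pencilCount_overlap (Sum.elim (fun _ => (1 : ℂ)) (fun _ => -1)) (Sum.elim A B) u v hu hv hpos K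
    hK S fun μ hμ => ?_
  obtain ⟨hμ', c, hc, hmin⟩ := hS μ hμ
  refine ⟨?_, c, hc, fun ν hν hFν => hmin ν hν ?_⟩
  · rw [unequalMoment_eq_expSum]; exact sub_ne_zero.2 hμ'
  · rw [unequalMoment_eq_expSum] at hFν; exact sub_ne_zero.1 hFν

/-- **Corollary (memo's verbatim shape): `≤ (2m)^(#K+1)` on every pencil plane of overlap `#K`.**  If the strictly
positive gradings are `θ₁ = αu + βv`, `θ₂ = γu + δv` (`α, β, γ, δ > 0`) for nonnegative `u, v` with `u_i + v_i > 0`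
separated off `K`, every finite set of `(θ₁ + cθ₂)`-pencil-visible unequal moments has at most `(2m)^(#K+1)` elements
(`θ₁ + cθ₂ = (α + cγ)(u + c'v)`, `c' = (β + cδ)/(α + cγ) > 0`). [folklore] -/
theorem liftedPencilCount_overlapPlane {m s : ℕ} (A B : Fin m → Fin s → ℂ) (θ₁ θ₂ u v : Fin s → ℝ)
    (hu : ∀ i, 0 ≤ u i) (hv : ∀ i, 0 ≤ v i) (hpos : ∀ i, 0 < u i + v i)
    (K : Finset (Fin s)) (hK : ∀ i, i ∉ K → u i = 0 ∨ v i = 0)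
    (α β γ δ : ℝ) (hα : 0 < α) (hβ : 0 < β) (hγ : 0 < γ) (hδ : 0 < δ)
    (h₁ : ∀ i, θ₁ i = α * u i + β * v i) (h₂ : ∀ i, θ₂ i = γ * u i + δ * v i) (S : Finset (Fin s → ℕ))
    (hS : ∀ μ ∈ S, (∑ j, ∏ i, A j i ^ μ i) ≠ (∑ j, ∏ i, B j i ^ μ i) ∧
      ∃ c : ℝ, 0 < c ∧ ∀ ν : Fin s → ℕ, ν ≠ μ →
        (∑ j, ∏ i, A j i ^ ν i) ≠ (∑ j, ∏ i, B j i ^ ν i) →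
          ∑ i, (θ₁ i + c * θ₂ i) * (μ i : ℝ) < ∑ i, (θ₁ i + c * θ₂ i) * (ν i : ℝ)) :
    S.card ≤ (2 * m) ^ (K.card + 1) := by
  refine liftedPencilCount_overlap A B u v hu hv hpos K hK S fun μ hμ => ⟨(hS μ hμ).1, ?_⟩
  obtain ⟨c, hc, hmin⟩ := (hS μ hμ).2
  have hαγ : 0 < α + c * γ := by positivity
  refine ⟨(β + c * δ) / (α + c * γ), by positivity, fun ν hν hG => ?_⟩
  have h := hmin ν hν hG
  have hcoef : ∀ i, θ₁ i + c * θ₂ i = (α + c * γ) * (u i + (β + c * δ) / (α + c * γ) * v i) := by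
    intro i
    rw [h₁ i, h₂ i]
    field_simp
    ring
  simp only [hcoef, mul_assoc, ← Finset.mul_sum] at h
  exact lt_of_mul_lt_mul_left h hαγ.le

end Summit.ValiantsHypothesis.ValiantsHypothesis.Theorems.NewtonUnitEquations.TwoProducts.FormalLogLinearisation

end
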